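import Summits.BirchSwinnertonDyer.BirchSwinnertonDyer.Theses.TameQuarticManinParity
import Literature.NumberTheory.EllipticCurves.ModularJacobianNeronDifferentialsTame
import Literature.NumberTheory.DiophantineGeometry.ConductorFactorizationProofs
import HarnessLib

/-!
# Route `TameQuarticManinParity`, LINE 41 (bsd-idea-3 g11), glue G41a `TprimeTameThreeOfColength`
# (stmt-BirchSwinnertonDyer-24076) — PROVED BY NAME (the planner's `Sketch41.g41a`)

Cell `pub/bsd-wall`, D-0145 line `route-BirchSwinnertonDyer-TeichmullerTwistDescent`, seat `bsd-line-ttd-p1` g15,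
working the planner-of-record's TQMP LINE 41. BSD is NOT proved by this; Manin's conjecture is not proved by this;
the crux COL(III) (`TprimeIIIColengthBound`, stmt-24044) stays OPEN and the named fact `nonempty_tameNeronFormsAt`
(existence of the Néron cotangent carrier) is a displayed hypothesis, hence the III cell E41
(`TprimeTameThreeOptimalManinUnit`, stmt-24070) stays OPEN. This file closes ONLY the glue.

## Statement (verbatim the route decl)

`ManinUnitIffTameColengthBound → TprimeIIIHasTameGoodModel → TprimeIIIColengthBound → nonempty_tameNeronFormsAt →
TprimeTameThreeOptimalManinUnit`.

## Proof

On a (t′) row `f₃ = 2` (`CondExpTwo` inside `SubTprime`), so `v₃(N) = 2` by the landed factorisation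
`N = ∏ p^{f_p}` (`factorization_conductorNorm_holds`); the named fact then supplies a carrier
`Λ : TameNeronFormsAt N 3 8` (`nonempty_tameNeronFormsAt_three`), S41 the good model with exponent `a = 2`, COL(III)
the bound `col_K ≤ 2`, and N38c turns it into `3 ∤ c`. Pure logic over landed theorems. Design: theorems only; no
definition, no named fact, no `sorry`; axioms `propext`, `Classical.choice`, `Quot.sound`.
-/

set_option autoImplicit false
-- D-0017: single-problem summit, so `Summit.BirchSwinnertonDyer.BirchSwinnertonDyer.…` repeats a namespace BY DESIGN.
set_option linter.dupNamespace false

namespace Summit.BirchSwinnertonDyer.BirchSwinnertonDyer.Theorems.TameQuarticManinParity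

open Summit.BirchSwinnertonDyer.BirchSwinnertonDyer.Theses.TameQuarticManinParity
open Summit.BirchSwinnertonDyer.Rank1Residual.Additive
open Literature.NumberTheory.EllipticCurves.ModularForms

/-- **`v₃(N) = 2` on the (t′) cell**: `SubTprime W 3` carries `f₃(W) = 2` (`CondExpTwo`), and the conductor
factorises as `N = ∏ p^{f_p}` (`factorization_conductorNorm_holds`). [cite: SilvermanATAEC1994, IV.10.2(b) and IV.10.4] -/
theorem padicValNat_conductorNorm_eq_two_of_subTprime (W : WeierstrassCurve ℚ) [W.IsElliptic]
    [W.IsGloballyMinimal] (ht : SubTprime W 3) : padicValNat 3 (W.conductorNorm ℤ) = 2 := by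
  haveI : Fact (Nat.Prime 3) := ⟨Nat.prime_three⟩
  have hf : (W.conductorNorm ℤ).factorization (Rat.HeightOneSpectrum.natGenerator (placeOf 3)) =
      W.conductorExponent (placeOf 3) :=
    WeierstrassCurve.factorization_conductorNorm_holds W (placeOf 3)
  have hgen : Rat.HeightOneSpectrum.natGenerator (placeOf 3) = 3 :=
    congrArg Subtype.val ((Rat.HeightOneSpectrum.primesEquiv (R := ℤ)).apply_symm_apply ⟨3, Nat.prime_three⟩)
  have h2 : W.conductorExponent (placeOf 3) = 2 := ht.2.1
  rw [hgen, h2, Nat.factorization_def _ Nat.prime_three] at hf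
  exact hf

/-- **Glue G41a** (stmt-BirchSwinnertonDyer-24076), by name: N38c (`3 ∤ c ⟺ col_K ≤ a`), S41 (good model over
`ℚ(ϖ)`, `ϖ⁸ = −3`, exponent `2` on the Kodaira-III rows), the crux COL(III) (`col_K ≤ 2`) and the existence of the
Néron cotangent carrier at `v₃(N) = 2` give the III cell `TprimeTameThreeOptimalManinUnit`.
[cite: EdixhovenManin1991, §4 Prop. 8] -/
theorem tprimeTameThreeOfColength_proof : TprimeTameThreeOfColength := by
  unfold TprimeTameThreeOfColength TprimeTameThreeOptimalManinUnit
  intro h43 hS h44 hne W _ _ _ hadd ht h3 D hL hopt hdeg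
  have h2 := padicValNat_conductorNorm_eq_two_of_subTprime W ht
  obtain ⟨Λ⟩ := nonempty_tameNeronFormsAt_three hne (W.conductorNorm ℤ) h2
  have hgood := hS W hadd ht h3
  exact (h43 (W.conductorNorm ℤ) Λ W D hL 2 hgood).2 (h44 W hadd ht h3 hgood Λ D hL hopt hdeg)

end Summit.BirchSwinnertonDyer.BirchSwinnertonDyer.Theorems.TameQuarticManinParity
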